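/-
COR-CM (cell pub-hodgecm2, stage 2 of the Hodge ladder) — count-neutral KERNEL COMBINATORICS «β − 1 faces for every cyclic Galois CM field»
(seat prover-pub-hodgecm2-b23-g38-0, binder prover b23, gen 38; claim CYCLIC-FACES F5, HOME/INBOX.md l.9031).  Theorems only; no geometry
beyond the tree's `Face` / `faceOfG`, no `Universe` field touched, no named fact, nothing asserted; seat b09's floors
(`CorCM/FaceCoinvariantFloor.lean`) and the INT2-GEN socket (`CorCM/FacePeriodsGeneratingSet.lean`) are used BY NAME; `Interfaces.lean` (C1),
every E term, B01 and `Transposition/*` are untouched.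
HONEST FRAMING (COORDINATOR RULING — HODGE FRAMING CORRECTION, 2026-08-21T11:55:35Z): `HC_CM` is NOT proved, here or anywhere in the
tree; this file produces no period and proves no face period for any field.
T5: n/a-class — the only Prop hypothesis binder displayed is INT2-GEN's period hypothesis on the produced face set (§2); no named-fact /
conjecture-def binder; checker: self (prover-pub-hodgecm2-b23-g38-0), 2026-08-22.
-/
import Summits.HodgeConjecture.CorCM.Census.CyclicFacesGenerate
import Summits.HodgeConjecture.CorCM.FaceCoinvariantFloor
import Summits.HodgeConjecture.CorCM.FacePeriodsGeneratingSet
import HarnessLib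

/-!
# Every cyclic Galois CM field has a generating set of `β − 1` rank-four faces, and none smaller

For a Galois CM field `F` whose group of Galois translates `GalT F` is CYCLIC (`ℚ(ζ_{p^k})` for `p` an odd prime and its imaginary
subfields; every cyclic CM field), write `β(F) = #Block conjT` for the number of blocks of abstract CM types (↔ the simple CM isogeny
classes split by `F`, [Milne1999, Prop. 2.1]); by seat b09's `BlockParity.card_block_mul_card_of_isCyclic`,
`β(F)·[F:ℚ] = Σ_{d ∣ [F:ℚ], d odd} φ(d)·2^{[F:ℚ]/2d}`.

* §1 **`exists_faces_hgen_of_isCyclic`**: for every base embedding `σ₀` there is a finite set `𝒮` of rank-four faces of `F` with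
  **`|𝒮| + 1 = β(F)`** satisfying the generation binder `hgen(𝒮, σ₀)` of INT2-GEN — every `σ₀`-Weil character of every face of `F` lies in the
  subgroup generated by the Weil characters of the faces of `𝒮` at all base embeddings.  This is the field form of the seat's
  `Census.CyclicFaces.exists_gfaces_generate_of_isCyclic_card_eq` (parts I–V of the lane: `β − 1` face orbits generate the integer Hodge
  lattice of a cyclic Galois CM type modulo pairs), read through `faceOfG` / `lefChar_corner_faceOfG` (`exists_faces_reading`), `mapDomain_weightRel_corner`
  (`span_translates_le_reads`) and b09's `hgen_of_weightRel_mem_span`.  With b09's face-coinvariant floor (`FaceCoinvariant.fibreTwo_le_card_of_hgen`) NO SMALLER SET DOES: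
  **`isLeast_card_faces_hgen_of_isCyclic`** — the least size of a face set with `hgen` is EXACTLY `β(F) − 1 = φ₂(F)`, for every cyclic
  Galois CM field, census-free and degree-uniform (the twisted degrees `≡ 0 (mod 4)` — `ℤ/8, ℤ/12, ℤ/16, ℤ/20, ℤ/24` in the censuses,
  `1, 5, 15, 51, 171` faces — included); the closed form `β(F)·[F:ℚ] = Σ_{d ∣ [F:ℚ], d odd} φ(d)·2^{[F:ℚ]/2/d}` is
  b09's `FaceParity.card_block_mul_finrank_of_isCyclic` (not restated).
* §2 **`hodgeConjectureFor_of_isCyclic_of_exists_facePeriod`** (INT2-GEN socket, BY NAME): if each of these `β(F) − 1` faces has a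
  non-vanishing period on the universe of record, the Hodge conjecture holds for every abelian variety dominated by a product of CM abelian
  varieties whose CM types come from subfields of `F` — CONDITIONAL on those periods; `HC_CM` is NOT proved.

References: [cite: Pohlmann1968, Thm. 1]; [cite: Milne1999LefschetzClasses, Thm. 3.2]; [cite: Shimura1998, §8.1 (p. 62)].
-/

noncomputable section

open CategoryTheory NumberField NumberField.ComplexEmbedding
open Literature.AlgebraicGeometry Literature.AlgebraicGeometry.Motives Literature.AlgebraicGeometry.HodgeTheory
open Literature.AlgebraicGeometry.ComplexMultiplication Literature.AlgebraicGeometry.Milne1999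
open Literature.NumberTheory.Automorphic
open Literature.NumberTheory.Automorphic.PicardCM
open Summit.HodgeConjecture.CorCM.Domination

namespace Summit.HodgeConjecture.CorCM.FaceCyclic

open Summit.HodgeConjecture.CorCM.Prior.AllgGroup.RfwfAllgGroup
open Summit.HodgeConjecture.CorCM.Census.BlockParity
open Summit.HodgeConjecture.CorCM.Census.Coinvariant

/-! ## §1 The generating face set of a cyclic Galois CM field -/

section Field

variable {F : Type} [Field F] [NumberField F]

/-- **The pair relations are base-change stable.** [folklore] -/
theorem mapDomain_rt_mem_pairRel [IsCMField F] [IsGalois ℚ F] (Q : GalT F) {z : CMF (GalT F) conjT →₀ ℤ}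
    (hz : z ∈ (pairRel : Submodule ℤ (CMF (GalT F) conjT →₀ ℤ))) :
    Finsupp.mapDomain (rt conjT Q) z ∈ (pairRel : Submodule ℤ (CMF (GalT F) conjT →₀ ℤ)) := by
  rw [FaceCoinvariant.pairRel_eq_span_pairSet] at hz ⊢
  have h : Submodule.map (Finsupp.lmapDomain ℤ ℤ (rt conjT Q)) (Submodule.span ℤ (pairSet (conjT : GalT F))) ≤
      Submodule.span ℤ (pairSet (conjT : GalT F)) := by
    rw [Submodule.map_span, Submodule.span_le]
    rintro _ ⟨y, ⟨Ψ, rfl⟩, rfl⟩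
    rw [Finsupp.lmapDomain_apply, mapDomain_rt_pair_eq conjT (fun P => FaceBasis.conjT_comm P) Q Ψ]
    exact Submodule.subset_span (pair_mem_pairSet conjT _)
  exact h (Submodule.mem_map_of_mem hz)

/-- **Base change of a read**: translating the `σ₀`-read of a face along `Q` gives its `Q σ₀`-read. [folklore] -/
theorem mapDomain_rt_weightRel_corner [IsGalois ℚ F] (σ₀ : F →+* ℂ) (Q : GalT F) (g : Face F) :
    Finsupp.mapDomain (rt conjT Q) (weightRel g.corner (fun _ => ({σ₀} : Finset (F →+* ℂ)))) =
      weightRel g.corner (fun _ => ({Q.1 σ₀} : Finset (F →+* ℂ))) := by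
  have hf : (fun Ψ : CMF (GalT F) conjT => pullType (pushType σ₀ Ψ) (Q.1 σ₀)) = rt conjT Q :=
    funext fun Ψ => FaceParity.pullType_pushType_eq_rt σ₀ Q Ψ
  rw [← hf]
  exact FaceCensus.mapDomain_weightRel_corner σ₀ Q g σ₀

/-- **Reads of geometric faces realise the abstract face relations modulo pairs**: for a finite set `S` of face relations there are at most
`|S|` faces of `F` whose `σ₀`-reads are the members of `S` modulo `pairRel` (`faceOfG`, `lefChar_corner_faceOfG`). [folklore] -/
theorem exists_faces_reading [IsGalois ℚ F] (σ₀ : F →+* ℂ) (S : Finset (CMF (GalT F) conjT →₀ ℤ))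
    (hS : (↑S : Set (CMF (GalT F) conjT →₀ ℤ)) ⊆ gfaceSet (GalT F) conjT conjT_mul_self) :
    ∃ 𝒮 : Finset (Face F), 𝒮.card ≤ S.card ∧ ∀ s ∈ S, ∃ g ∈ 𝒮,
      weightRel g.corner (fun _ => ({σ₀} : Finset (F →+* ℂ))) - s ∈ (pairRel : Submodule ℤ (CMF (GalT F) conjT →₀ ℤ)) := by
  classical
  induction S using Finset.induction_on with
  | empty => exact ⟨∅, le_rfl, fun s hs => absurd hs (Finset.notMem_empty _)⟩
  | insert a S ha ih =>
    obtain ⟨𝒮, hcard, hread⟩ := ih fun s hs => hS (Finset.mem_coe.mpr (Finset.mem_insert_of_mem (Finset.mem_coe.mp hs)))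
    obtain ⟨Φ, t, t', ht', ha'⟩ := hS (Finset.mem_coe.mpr (Finset.mem_insert_self a S))
    refine ⟨insert (faceOfG σ₀ Φ t t' ht') 𝒮, ?_, fun s hs => ?_⟩
    · rw [Finset.card_insert_of_notMem ha]
      exact (Finset.card_insert_le _ _).trans (by omega)
    · rcases Finset.mem_insert.mp hs with hsa | hs
      · refine ⟨faceOfG σ₀ Φ t t' ht', Finset.mem_insert_self _ _, ?_⟩
        rw [hsa, ha', ← Submodule.Quotient.mk_eq_zero, Submodule.Quotient.mk_sub]
        change abar _ - abar _ = 0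
        rw [abar_weightRel, lefChar_corner_faceOfG, sub_self]
      · obtain ⟨g, hg, h⟩ := hread s hs
        exact ⟨g, Finset.mem_insert_of_mem hg, h⟩

/-- **Base changes of realised relations are reads**: if the `σ₀`-reads of `𝒮` realise `S` modulo pairs, then `ℤ⟨pairs⟩ + ℤ⟨base changes of S⟩`
lies in the module generated by all reads of `𝒮` and the pair relations. [folklore] -/
theorem span_translates_le_reads [IsCMField F] [IsGalois ℚ F] (σ₀ : F →+* ℂ) (S : Finset (CMF (GalT F) conjT →₀ ℤ))
    (𝒮 : Set (Face F)) (hread : ∀ s ∈ S, ∃ g ∈ 𝒮,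
      weightRel g.corner (fun _ => ({σ₀} : Finset (F →+* ℂ))) - s ∈ (pairRel : Submodule ℤ (CMF (GalT F) conjT →₀ ℤ))) :
    Submodule.span ℤ (pairSet (conjT : GalT F)) ⊔ Submodule.span ℤ (translates conjT S) ≤
      Submodule.span ℤ {y : CMF (GalT F) conjT →₀ ℤ | ∃ g ∈ 𝒮, ∃ σ : F →+* ℂ,
        y = weightRel g.corner (fun _ => ({σ} : Finset (F →+* ℂ)))} ⊔ pairRel := by
  refine sup_le ?_ ?_
  · rw [← FaceCoinvariant.pairRel_eq_span_pairSet]; exact le_sup_right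
  · rw [Submodule.span_le]
    rintro _ ⟨Q, s, hs, rfl⟩
    obtain ⟨g, hg, hgs⟩ := hread s hs
    have hdiff := mapDomain_rt_mem_pairRel Q hgs
    have hsub : Finsupp.mapDomain (rt conjT Q) (weightRel g.corner (fun _ => ({σ₀} : Finset (F →+* ℂ))) - s) =
        weightRel g.corner (fun _ => ({Q.1 σ₀} : Finset (F →+* ℂ))) - Finsupp.mapDomain (rt conjT Q) s := by
      rw [← mapDomain_rt_weightRel_corner σ₀ Q g]
      exact map_sub (Finsupp.lmapDomain ℤ ℤ (rt conjT Q)) _ _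
    rw [hsub] at hdiff
    rw [SetLike.mem_coe, ← sub_sub_cancel (weightRel g.corner (fun _ => ({Q.1 σ₀} : Finset (F →+* ℂ)))) (Finsupp.mapDomain (rt conjT Q) s)]
    exact Submodule.sub_mem _ (Submodule.mem_sup_left (Submodule.subset_span ⟨g, hg, Q.1 σ₀, rfl⟩)) (Submodule.mem_sup_right hdiff)

/-- **EVERY CYCLIC GALOIS CM FIELD HAS `β − 1` GENERATING FACES.**  For `F` Galois CM with cyclic `GalT F` and any base embedding `σ₀`:
a finite set `𝒮` of rank-four faces with `|𝒮| + 1 = β(F) = #Block conjT` and `hgen(𝒮, σ₀)`. [folklore] -/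
theorem exists_faces_hgen_of_isCyclic [IsCMField F] [IsGalois ℚ F] [IsCyclic (GalT F)] (σ₀ : F →+* ℂ) :
    ∃ 𝒮 : Finset (Face F), 𝒮.card + 1 = Fintype.card (Block (conjT : GalT F)) ∧
      ∀ f : Face F, lefChar f.corner (fun _ => ({σ₀} : Finset (F →+* ℂ))) ∈ AddSubgroup.closure
        {a : Asym F | ∃ g ∈ (𝒮 : Set (Face F)), ∃ σ : F →+* ℂ, a = lefChar g.corner (fun _ => ({σ} : Finset (F →+* ℂ)))} := by
  obtain ⟨S, hS, hcard, -, hgenr⟩ :=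
    Census.CyclicFaces.exists_gfaces_generate_of_isCyclic_card_eq (conjT : GalT F) conjT_mul_self conjT_ne_one
  obtain ⟨𝒮, h𝒮card, hread⟩ := exists_faces_reading σ₀ S hS
  have hle := span_translates_le_reads σ₀ S (𝒮 : Set (Face F))
    (fun s hs => by obtain ⟨g, hg, h⟩ := hread s hs; exact ⟨g, Finset.mem_coe.mpr hg, h⟩)
  have hgen : ∀ f : Face F, lefChar f.corner (fun _ => ({σ₀} : Finset (F →+* ℂ))) ∈ AddSubgroup.closure
      {a : Asym F | ∃ g ∈ (𝒮 : Set (Face F)), ∃ σ : F →+* ℂ, a = lefChar g.corner (fun _ => ({σ} : Finset (F →+* ℂ)))} :=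
    hgen_of_weightRel_mem_span (𝒮 : Set (Face F)) σ₀ fun f => hle (hgenr (FaceCoinvariant.weightRel_corner_mem_hodgeSpan f σ₀))
  refine ⟨𝒮, le_antisymm (by omega) ?_, hgen⟩
  have h1 := FaceCoinvariant.fibreTwo_le_card_of_hgen 𝒮 σ₀ hgen
  have h2 := FaceCoinvariant.fibreTwo_add_one_eq_card_block_of_isCyclic (F := F)
  omega

/-- **… AND NONE SMALLER**: the least size of a face set `𝒮` with `hgen(𝒮, σ₀)` is exactly `β(F) − 1` (`= φ₂(F)`, b09's face-coinvariant
floor), for every cyclic Galois CM field and every base embedding. [folklore] -/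
theorem isLeast_card_faces_hgen_of_isCyclic [IsCMField F] [IsGalois ℚ F] [IsCyclic (GalT F)] (σ₀ : F →+* ℂ) :
    IsLeast {m : ℕ | ∃ 𝒮 : Finset (Face F), 𝒮.card = m ∧
      ∀ f : Face F, lefChar f.corner (fun _ => ({σ₀} : Finset (F →+* ℂ))) ∈ AddSubgroup.closure
        {a : Asym F | ∃ g ∈ (𝒮 : Set (Face F)), ∃ σ : F →+* ℂ, a = lefChar g.corner (fun _ => ({σ} : Finset (F →+* ℂ)))}}
      (Fintype.card (Block (conjT : GalT F)) - 1) := by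
  have hβ := FaceCoinvariant.fibreTwo_add_one_eq_card_block_of_isCyclic (F := F)
  constructor
  · obtain ⟨𝒮, hcard, hgen⟩ := exists_faces_hgen_of_isCyclic σ₀
    exact ⟨𝒮, by omega, hgen⟩
  · rintro m ⟨𝒮, rfl, hgen⟩
    have h1 := FaceCoinvariant.fibreTwo_le_card_of_hgen 𝒮 σ₀ hgen
    omega

end Field

/-! ## §2 The Hodge-conjecture reading through the INT2-GEN socket (conditional on the face periods) -/

/-- **HC for the slice of a cyclic Galois CM field from `β − 1` face periods** (INT2-GEN socket BY NAME; CONDITIONAL on the periods —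
`HC_CM` is NOT proved): for `K` Galois CM of degree `≥ 6` with cyclic `GalT K` there is a face set `𝒮` with `|𝒮| + 1 = β(K)` such that,
if every face of `𝒮` has a non-vanishing period on the universe of record, the Hodge conjecture holds for every abelian variety dominated
by a product of CM abelian varieties with CM by subfields of `K`.
[cite: Shimura1998, §6.2 Theorem 3 and §6.1 Corollary of Theorem 2 (pp. 41–43)] [cite: Pohlmann1968, Thm. 1]
[cite: Milne1999LefschetzClasses, Thm. 3.2 and Cor. 4.5] [cite: MumfordAV1970, §19 Thm. 1 and p. 169] -/
theorem hodgeConjectureFor_of_isCyclic_of_exists_facePeriod (K : CMField) [hGal : IsGalois ℚ K] [IsCyclic (GalT K)]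
    (h6 : 6 ≤ Module.finrank ℚ K) (σ₀ : (K : Type) →+* ℂ) :
    ∃ 𝒮 : Finset (Face K), 𝒮.card + 1 = Fintype.card (Block (conjT : GalT K)) ∧
      ((∀ f ∈ 𝒮, ∃ ι₁ : K →+* ℂ, f.Admissible ι₁ ∧ ∃ (V : HermSpace3 K ι₁) (σ : K →+* ℂ),
        (Model.picardCMUniverse exists_isReal_hodgeModel_holds hodgePQ_independent_of_hodgeModel_holds
          BallQuotient.ballQuotientUniformised_holds cmAbelianVarietyRealised_holds).PeriodNV ι₁ V K f.psi σ) →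
      ∀ {P B : AbelianVariety ℂ}, AbelianVariety.IsProductOf (fun B : AbelianVariety ℂ =>
        ∃ (E : Type) (_ : Field E) (_ : NumberField E) (_ : IsCMField E) (_ : E →+* (K : Type)) (Φ : CMType E)
          (ι : 𝓞 E →+* End B) (θ : E →+* Module.End ℂ (complexBetti B.X 1)),
          IsCMTypeRealisation Φ B ι θ) P →
      AVDominatedBy B P → HodgeConjectureFor B.dim B.X) := by
  obtain ⟨𝒮, hcard, hgen⟩ := exists_faces_hgen_of_isCyclic (F := K) σ₀
  refine ⟨𝒮, hcard, fun h P B hP hB => ?_⟩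
  exact hodgeConjectureFor_of_avDominatedBy_isProductOf_of_exists_facePeriod_on K h6 (𝒮 : Set (Face K)) σ₀ hgen
    (fun f hf => h f (Finset.mem_coe.mp hf)) hP hB

end Summit.HodgeConjecture.CorCM.FaceCyclic

end
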